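import Summits.MatrixMultiplication.MatrixMultiplication.Theorems.OutsiderSandwichToricCeilingPowTwoCwBaseDataB

/-!
# OutsiderSandwich — toric ceiling of `cw₂^{⊠N}`: the `N = 3` two-cw base census, kernel checks B
(groups `cX3`, `cX4`, `cX5`; decomp-mm lens 4, gen 47, kernel K47-6 census B; THESES-FREE, `ω`-free;
helper toward `LaserTangency`, stmt-32268)

LABEL.  TORIC · FINITE (`N = 3`) · NEC-side instrument.  For each group `cXk`: the certificate list
`datak` (`…TwoCwBaseDataB`) has the length of the instance list `instOf cXk` (`lenk`), and — in
CHUNKS of at most 150 instances, to respect the kernel's memory ceiling on the gate — every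
certificate decodes to a `valid` perfect matching of `cw ⊠ cw ⊠ D` minus its instance
(`censusk_r`, `decide +kernel`, standard axioms; no `native_decide`, no `ofReduceBool`); `coverk`
records that the chunks cover all indices.  Consumed by `…TwoCwBase` (`good_k`, `census_all`).
WHAT THIS IS NOT: no statement about tensors or `ω`.
-/

set_option linter.dupNamespace false
set_option maxRecDepth 200000
set_option Elab.async false

namespace Summit.MatrixMultiplication.MatrixMultiplication.Theorems.OutsiderSandwichToricCeilingPowTwoCwBaseCensusB

open Summit.MatrixMultiplication.MatrixMultiplication.Theorems.OutsiderSandwichToricCeilingPowTwoCwBaseDefs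
open Summit.MatrixMultiplication.MatrixMultiplication.Theorems.OutsiderSandwichToricCeilingPowTwoCwBaseDataB

set_option maxHeartbeats 0 in
/-- Group `cX3`: the certificate list has the length of the instance list (340). -/
theorem len3 : (instOf cX3).length = data3.length := by
  decide +kernel

/-- Group `cX3`: number of certificates. -/
theorem dlen3 : data3.length = 340 := by
  decide +kernel

set_option maxHeartbeats 0 in
/-- CENSUS, group `cX3`, instances `0 … 149` (kernel-decided): each certificate decodes to a valid
perfect matching of its instance. -/
theorem census3_0 : ((((instOf cX3).zip data3).drop 0).take 150).all
    (fun p => goodD p.1 p.2) = true := by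
  decide +kernel

set_option maxHeartbeats 0 in
/-- CENSUS, group `cX3`, instances `150 … 299` (kernel-decided): each certificate decodes to a valid
perfect matching of its instance. -/
theorem census3_1 : ((((instOf cX3).zip data3).drop 150).take 150).all
    (fun p => goodD p.1 p.2) = true := by
  decide +kernel

set_option maxHeartbeats 0 in
/-- CENSUS, group `cX3`, instances `300 … 339` (kernel-decided): each certificate decodes to a valid
perfect matching of its instance. -/
theorem census3_2 : ((((instOf cX3).zip data3).drop 300).take 40).all
    (fun p => goodD p.1 p.2) = true := by
  decide +kernel

/-- Group `cX3`: every index is covered by a decided chunk. -/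
theorem cover3 : ∀ i < data3.length, ∃ lo n, lo ≤ i ∧ i < lo + n ∧
    ((((instOf cX3).zip data3).drop lo).take n).all (fun p => goodD p.1 p.2) = true := by
  intro i hi
  rw [dlen3] at hi
  by_cases h0 : i < 150
  · exact ⟨0, 150, by omega, by omega, census3_0⟩
  by_cases h1 : i < 300
  · exact ⟨150, 150, by omega, by omega, census3_1⟩
  · exact ⟨300, 40, by omega, by omega, census3_2⟩

set_option maxHeartbeats 0 in
/-- Group `cX4`: the certificate list has the length of the instance list (184). -/
theorem len4 : (instOf cX4).length = data4.length := by
  decide +kernel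

/-- Group `cX4`: number of certificates. -/
theorem dlen4 : data4.length = 184 := by
  decide +kernel

set_option maxHeartbeats 0 in
/-- CENSUS, group `cX4`, instances `0 … 149` (kernel-decided): each certificate decodes to a valid
perfect matching of its instance. -/
theorem census4_0 : ((((instOf cX4).zip data4).drop 0).take 150).all
    (fun p => goodD p.1 p.2) = true := by
  decide +kernel

set_option maxHeartbeats 0 in
/-- CENSUS, group `cX4`, instances `150 … 183` (kernel-decided): each certificate decodes to a valid
perfect matching of its instance. -/
theorem census4_1 : ((((instOf cX4).zip data4).drop 150).take 34).all
    (fun p => goodD p.1 p.2) = true := by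
  decide +kernel

/-- Group `cX4`: every index is covered by a decided chunk. -/
theorem cover4 : ∀ i < data4.length, ∃ lo n, lo ≤ i ∧ i < lo + n ∧
    ((((instOf cX4).zip data4).drop lo).take n).all (fun p => goodD p.1 p.2) = true := by
  intro i hi
  rw [dlen4] at hi
  by_cases h0 : i < 150
  · exact ⟨0, 150, by omega, by omega, census4_0⟩
  · exact ⟨150, 34, by omega, by omega, census4_1⟩

set_option maxHeartbeats 0 in
/-- Group `cX5`: the certificate list has the length of the instance list (376). -/
theorem len5 : (instOf cX5).length = data5.length := by
  decide +kernel

/-- Group `cX5`: number of certificates. -/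
theorem dlen5 : data5.length = 376 := by
  decide +kernel

set_option maxHeartbeats 0 in
/-- CENSUS, group `cX5`, instances `0 … 149` (kernel-decided): each certificate decodes to a valid
perfect matching of its instance. -/
theorem census5_0 : ((((instOf cX5).zip data5).drop 0).take 150).all
    (fun p => goodD p.1 p.2) = true := by
  decide +kernel

set_option maxHeartbeats 0 in
/-- CENSUS, group `cX5`, instances `150 … 299` (kernel-decided): each certificate decodes to a valid
perfect matching of its instance. -/
theorem census5_1 : ((((instOf cX5).zip data5).drop 150).take 150).all
    (fun p => goodD p.1 p.2) = true := by
  decide +kernel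

set_option maxHeartbeats 0 in
/-- CENSUS, group `cX5`, instances `300 … 375` (kernel-decided): each certificate decodes to a valid
perfect matching of its instance. -/
theorem census5_2 : ((((instOf cX5).zip data5).drop 300).take 76).all
    (fun p => goodD p.1 p.2) = true := by
  decide +kernel

/-- Group `cX5`: every index is covered by a decided chunk. -/
theorem cover5 : ∀ i < data5.length, ∃ lo n, lo ≤ i ∧ i < lo + n ∧
    ((((instOf cX5).zip data5).drop lo).take n).all (fun p => goodD p.1 p.2) = true := by
  intro i hi
  rw [dlen5] at hi
  by_cases h0 : i < 150
  · exact ⟨0, 150, by omega, by omega, census5_0⟩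
  by_cases h1 : i < 300
  · exact ⟨150, 150, by omega, by omega, census5_1⟩
  · exact ⟨300, 76, by omega, by omega, census5_2⟩

end Summit.MatrixMultiplication.MatrixMultiplication.Theorems.OutsiderSandwichToricCeilingPowTwoCwBaseCensusB
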